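import Summits.CriticalPhenomena.PercolationContinuityZ3.Theorems.PercNearOneGluingNoHeavyLowerTailAPLLadderApex
import HarnessLib

/-!
# `NoHeavyLowerTail` (stmt-CriticalPhenomena-4575) — BEYOND SERIES–PARALLEL: the hub-path cores `K_{3,n}` and a kernel-certified
# three-point ratio `E = κ²/(pπm) > 1.06 > 28/27`

Support file (prover prim-ineq-gen-8 gen 62; `--supports stmt-CriticalPhenomena-4575`; memo
run/shared/lean/prim/prim-ineq-gen-8/FINDING-gen62-BEYONDSP.md).  No definitions, no named facts, no sorries.

Setting of `…APLSeriesParallel` / `…APLLadderCells`: weights `p` on `Sym2 V`, `DecisionTree.PrW`, clusters `Gladkov.cl`; for an apex `a` and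
ports `b, c` on an edge set `D` the five cells `P(a|b|c)`, `P(ab|c)`, `P(ac|b)`, `P(a|bc)`, `P(abc)` and the four numbers `p = P(b ∈ cl a)`,
`π = P(c ∈ cl a)`, `τ = P(b, c ∈ cl a)`, `m = P(b ∉ cl a, c ∈ cl b)`; `E = (τ − pπ)²/(pπm)`.
The series–parallel theorem `sp_E_le` gives `E ≤ 28/27` for the apex over every two-terminal series–parallel network (sharp there,
`sp_E_le_sharp`).  This file certifies that `28/27` is NOT a universal constant: the smallest non-series–parallel cores already exceed it.
* `parallel_iso_mul` — under parallel composition (union of edge sets glued at the three terminals) the four ISOLATION COORDINATES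
  `P(a|b|c)`, `P(a|b|c) + P(ab|c)` (`c` isolated), `P(a|b|c) + P(ac|b)` (`b` isolated), `P(a|b|c) + P(a|bc)` (`a` isolated) MULTIPLY
  (corollary of the union lemma `glued_cell_*`).
* `hubPath_numbers` — the HUB PATH `{s(g,x), s(x,u), s(x,v)}` (weights `h, a, b`) as a `(g; u, v)`-network: `(p, π, τ, m) = (ha, hb, hab, (1−h)ab)`.
* `hubPaths_iso`, `hubPaths_numbers` — `n` hub paths through distinct middle vertices `x 0, …, x (n−1)` in parallel (the core `{g,u,v} × {x_i}`
  `= K_{3,n}`): isolation coordinates `Zⁿ, Wⁿ, Uⁿ, Oⁿ` with `Z = 1 − ha − hb − ab + 2hab`, `W = 1 − hb − ab + hab`, `U = 1 − ha − ab + hab`,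
  `O = 1 − ha − hb + hab`, hence `p = 1 − Uⁿ − Oⁿ + Zⁿ`, `π = 1 − Wⁿ − Oⁿ + Zⁿ`, `τ = 1 − Wⁿ − Uⁿ − Oⁿ + 2Zⁿ`, `m = Oⁿ − Zⁿ`.
* `hubPaths_threePoint_gt` — for `n = 4`, `a = b = h = 1/3` (`Z = 20/27`, `W = U = O = 22/27`): the three-point ratio of the CORE
  `P(u,v ∈ cl g)²/(P(u ∈ cl g)P(v ∈ cl g)P(v ∈ cl u)) = 148673²·3¹²/222929³ = 1.06027…`, so the three-point inequality `sp_threePoint_le'`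
  (constant `28/27` inside series–parallel graphs) fails for the core `K_{3,4}`: `(106/100)·P(u ∈ cl g)P(v ∈ cl g)P(v ∈ cl u) < P(u,v ∈ cl g)²`.
* `hubPaths_apex_excess`, **`exists_E_gt_beyondSP`** — with the apex `o` PENDANT at `g` (edge `s(o,g)` of weight `10⁻⁴`, `pendant_apex_numbers`):
  an explicit weighted graph on `Fin 8` (13 edges, weights in `[0,1]`) with `(53/50)·P(u ∈ cl o)P(v ∈ cl o)P(u ∉ cl o, v ∈ cl u) <
  (P(u,v ∈ cl o) − P(u ∈ cl o)P(v ∈ cl o))²` and `pπm > 0`, i.e. **`E > 1.06 > 28/27`**: the supremum of `E` over all finite weighted graphs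
  strictly exceeds the series–parallel supremum `28/27` (numerically the `K_{3,n}` optimum is `n = 4`, `q = 0.3269`, `E → 1.06039`; memo §1).
[this work]
-/

namespace Summit.CriticalPhenomena.PercolationContinuityZ3.Theorems

namespace APL

open Literature.Probability.Percolation Literature.Probability.Percolation.Gladkov Literature.Probability.Percolation.DecisionTree
open scoped Classical

variable {V : Type*} [Fintype V]

/-! ### Isolation coordinates multiply under parallel composition -/

/-- **Isolation coordinates multiply.**  For disjoint edge sets `D₁, D₂` glued only at the terminals `a, b, c`, each of
`P(a|b|c)`, `P(a|b|c) + P(ab|c)`, `P(a|b|c) + P(ac|b)`, `P(a|b|c) + P(a|bc)` on `D₁ ∪ D₂` is the product of the same quantity on `D₁` and on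
`D₂` (a terminal is isolated from the other two in the union iff it is so in both pieces). [this work] -/
theorem parallel_iso_mul (p : Sym2 V → ℝ) (D₁ D₂ : Finset (Sym2 V)) (hdisj : Disjoint D₁ D₂) (a b c : V)
    (hsep : ∀ v : V, (∃ e ∈ D₁, v ∈ e) → (∃ e ∈ D₂, v ∈ e) → (v = a ∨ v = b ∨ v = c)) :
    PrW (D₁ ∪ D₂) p {K : Finset (Sym2 V) | b ∉ cl K a ∧ c ∉ cl K a ∧ c ∉ cl K b}
      = PrW D₁ p {K : Finset (Sym2 V) | b ∉ cl K a ∧ c ∉ cl K a ∧ c ∉ cl K b}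
        * PrW D₂ p {K : Finset (Sym2 V) | b ∉ cl K a ∧ c ∉ cl K a ∧ c ∉ cl K b}
    ∧ PrW (D₁ ∪ D₂) p {K : Finset (Sym2 V) | b ∉ cl K a ∧ c ∉ cl K a ∧ c ∉ cl K b} + PrW (D₁ ∪ D₂) p {K : Finset (Sym2 V) | b ∈ cl K a ∧ c ∉ cl K a}
      = (PrW D₁ p {K : Finset (Sym2 V) | b ∉ cl K a ∧ c ∉ cl K a ∧ c ∉ cl K b} + PrW D₁ p {K : Finset (Sym2 V) | b ∈ cl K a ∧ c ∉ cl K a})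
        * (PrW D₂ p {K : Finset (Sym2 V) | b ∉ cl K a ∧ c ∉ cl K a ∧ c ∉ cl K b} + PrW D₂ p {K : Finset (Sym2 V) | b ∈ cl K a ∧ c ∉ cl K a})
    ∧ PrW (D₁ ∪ D₂) p {K : Finset (Sym2 V) | b ∉ cl K a ∧ c ∉ cl K a ∧ c ∉ cl K b} + PrW (D₁ ∪ D₂) p {K : Finset (Sym2 V) | c ∈ cl K a ∧ b ∉ cl K a}
      = (PrW D₁ p {K : Finset (Sym2 V) | b ∉ cl K a ∧ c ∉ cl K a ∧ c ∉ cl K b} + PrW D₁ p {K : Finset (Sym2 V) | c ∈ cl K a ∧ b ∉ cl K a})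
        * (PrW D₂ p {K : Finset (Sym2 V) | b ∉ cl K a ∧ c ∉ cl K a ∧ c ∉ cl K b} + PrW D₂ p {K : Finset (Sym2 V) | c ∈ cl K a ∧ b ∉ cl K a})
    ∧ PrW (D₁ ∪ D₂) p {K : Finset (Sym2 V) | b ∉ cl K a ∧ c ∉ cl K a ∧ c ∉ cl K b}
        + PrW (D₁ ∪ D₂) p {K : Finset (Sym2 V) | b ∉ cl K a ∧ c ∉ cl K a ∧ c ∈ cl K b}
      = (PrW D₁ p {K : Finset (Sym2 V) | b ∉ cl K a ∧ c ∉ cl K a ∧ c ∉ cl K b} + PrW D₁ p {K : Finset (Sym2 V) | b ∉ cl K a ∧ c ∉ cl K a ∧ c ∈ cl K b})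
        * (PrW D₂ p {K : Finset (Sym2 V) | b ∉ cl K a ∧ c ∉ cl K a ∧ c ∉ cl K b}
            + PrW D₂ p {K : Finset (Sym2 V) | b ∉ cl K a ∧ c ∉ cl K a ∧ c ∈ cl K b}) := by
  rw [glued_cell_zero p D₁ D₂ hdisj a b c hsep, glued_cell_ab p D₁ D₂ hdisj a b c hsep, glued_cell_ac p D₁ D₂ hdisj a b c hsep,
    glued_cell_bc p D₁ D₂ hdisj a b c hsep]
  exact ⟨rfl, by ring, by ring, by ring⟩

/-! ### The hub path -/

/-- **The hub path** `{s(g,x)} ∪ ({s(x,u)} ∪ {s(x,v)})` (`g, x, u, v` pairwise distinct, weights `h = p s(g,x)`, `a = p s(x,u)`, `b = p s(x,v)`)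
as a `(g; u, v)`-network: `P(u ∈ cl g) = ha`, `P(v ∈ cl g) = hb`, `P(u, v ∈ cl g) = hab`, `P(u ∉ cl g, v ∈ cl u) = ab − hab`
(`pendant_apex_numbers` over the path `u — x — v` of `vee_numbers`). [this work] -/
theorem hubPath_numbers (p : Sym2 V → ℝ) (g x u v : V) (hgx : g ≠ x) (hgu : g ≠ u) (hgv : g ≠ v) (hxu : x ≠ u) (hxv : x ≠ v)
    (huv : u ≠ v) :
    PrW (insert s(g, x) ({s(x, u)} ∪ {s(x, v)})) p {K : Finset (Sym2 V) | u ∈ cl K g} = p s(g, x) * p s(x, u)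
    ∧ PrW (insert s(g, x) ({s(x, u)} ∪ {s(x, v)})) p {K : Finset (Sym2 V) | v ∈ cl K g} = p s(g, x) * p s(x, v)
    ∧ PrW (insert s(g, x) ({s(x, u)} ∪ {s(x, v)})) p {K : Finset (Sym2 V) | u ∈ cl K g ∧ v ∈ cl K g}
        = p s(g, x) * (p s(x, u) * p s(x, v))
    ∧ PrW (insert s(g, x) ({s(x, u)} ∪ {s(x, v)})) p {K : Finset (Sym2 V) | u ∉ cl K g ∧ v ∈ cl K u}
        = p s(x, u) * p s(x, v) - p s(g, x) * (p s(x, u) * p s(x, v)) := by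
  have hR : ∀ f ∈ ({s(x, u)} ∪ {s(x, v)} : Finset (Sym2 V)), g ∉ f := fun f hf hg => by
    rw [Finset.mem_union, Finset.mem_singleton, Finset.mem_singleton] at hf
    rcases hf with rfl | rfl
    · rcases Sym2.mem_iff.1 hg with h | h
      · exact hgx h
      · exact hgu h
    · rcases Sym2.mem_iff.1 hg with h | h
      · exact hgx h
      · exact hgv h
  obtain ⟨vp, vπ, vτ, vm⟩ := vee_numbers p x u v hxu hxv huv
  obtain ⟨ap, aπ, aτ, am⟩ := pendant_apex_numbers p ({s(x, u)} ∪ {s(x, v)}) g x u v hgx hgu.symm hgv.symm hR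
  rw [ap, aπ, aτ, am, vp, vπ, vτ, vm]
  exact ⟨rfl, rfl, rfl, by ring⟩

/-- The five cells of the hub path (`P(g|u|v)`, `P(gu|v)`, `P(gv|u)`, `P(g|uv)`, `P(guv)`) in terms of `h, a, b`:
`(1 − ha − hb − ab + 2hab, ha − hab, hb − hab, ab − hab, hab)`. [this work] -/
theorem hubPath_cells (p : Sym2 V → ℝ) (g x u v : V) (hgx : g ≠ x) (hgu : g ≠ u) (hgv : g ≠ v) (hxu : x ≠ u) (hxv : x ≠ v)
    (huv : u ≠ v) :
    PrW (insert s(g, x) ({s(x, u)} ∪ {s(x, v)})) p {K : Finset (Sym2 V) | u ∉ cl K g ∧ v ∉ cl K g ∧ v ∉ cl K u}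
        = 1 - p s(g, x) * p s(x, u) - p s(g, x) * p s(x, v) - p s(x, u) * p s(x, v) + 2 * (p s(g, x) * p s(x, u) * p s(x, v))
    ∧ PrW (insert s(g, x) ({s(x, u)} ∪ {s(x, v)})) p {K : Finset (Sym2 V) | u ∈ cl K g ∧ v ∉ cl K g}
        = p s(g, x) * p s(x, u) - p s(g, x) * p s(x, u) * p s(x, v)
    ∧ PrW (insert s(g, x) ({s(x, u)} ∪ {s(x, v)})) p {K : Finset (Sym2 V) | v ∈ cl K g ∧ u ∉ cl K g}
        = p s(g, x) * p s(x, v) - p s(g, x) * p s(x, u) * p s(x, v)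
    ∧ PrW (insert s(g, x) ({s(x, u)} ∪ {s(x, v)})) p {K : Finset (Sym2 V) | u ∉ cl K g ∧ v ∉ cl K g ∧ v ∈ cl K u}
        = p s(x, u) * p s(x, v) - p s(g, x) * p s(x, u) * p s(x, v)
    ∧ PrW (insert s(g, x) ({s(x, u)} ∪ {s(x, v)})) p {K : Finset (Sym2 V) | u ∈ cl K g ∧ v ∈ cl K g}
        = p s(g, x) * p s(x, u) * p s(x, v) := by
  obtain ⟨np, nπ, nτ, nm⟩ := hubPath_numbers p g x u v hgx hgu hgv hxu hxv huv
  set D : Finset (Sym2 V) := insert s(g, x) ({s(x, u)} ∪ {s(x, v)})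
  have hsum := cells_sum_eq_one p D g u v
  rw [conn_eq_cells_b p D g u v] at np
  rw [conn_eq_cells_c p D g u v] at nπ
  rw [m_event_eq_cell p D g u v] at nm
  rw [nτ] at np nπ
  refine ⟨?_, ?_, ?_, ?_, ?_⟩
  · linear_combination hsum - np - nπ - nm - nτ
  · linear_combination np
  · linear_combination nπ
  · linear_combination nm
  · linear_combination nτ

/-! ### `n` hub paths in parallel: the core `K_{3,n}` -/

section HubPaths

variable (x : ℕ → V) (g u v : V) (K : ℕ → Finset (Sym2 V))
  (hK0 : K 0 = ∅) (hKs : ∀ r : ℕ, K (r + 1) = K r ∪ insert s(g, x r) ({s(x r, u)} ∪ {s(x r, v)}))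

include hK0 hKs

omit [Fintype V] in
/-- Every vertex of an edge of `K n` is `g`, `u`, `v` or a middle vertex `x j`, `j < n`. [folklore] -/
theorem hubPaths_vertex (n : ℕ) {e : Sym2 V} (he : e ∈ K n) {y : V} (hy : y ∈ e) :
    y = g ∨ y = u ∨ y = v ∨ ∃ j, j < n ∧ y = x j := by
  induction n with
  | zero => rw [hK0] at he; exact absurd he (Finset.notMem_empty e)
  | succ r ih =>
    rw [hKs r, Finset.mem_union, Finset.mem_insert, Finset.mem_union, Finset.mem_singleton, Finset.mem_singleton] at he
    rcases he with he | rfl | rfl | rfl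
    · rcases ih he with h | h | h | ⟨j, hj, h⟩
      · exact Or.inl h
      · exact Or.inr (Or.inl h)
      · exact Or.inr (Or.inr (Or.inl h))
      · exact Or.inr (Or.inr (Or.inr ⟨j, by omega, h⟩))
    · rcases Sym2.mem_iff.1 hy with rfl | rfl
      · exact Or.inl rfl
      · exact Or.inr (Or.inr (Or.inr ⟨r, by omega, rfl⟩))
    · rcases Sym2.mem_iff.1 hy with rfl | rfl
      · exact Or.inr (Or.inr (Or.inr ⟨r, by omega, rfl⟩))
      · exact Or.inr (Or.inl rfl)
    · rcases Sym2.mem_iff.1 hy with rfl | rfl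
      · exact Or.inr (Or.inr (Or.inr ⟨r, by omega, rfl⟩))
      · exact Or.inr (Or.inr (Or.inl rfl))

/-- **Isolation coordinates of `n` hub paths in parallel** (weights `h = p s(g, x r)`, `a = p s(x r, u)`, `b = p s(x r, v)` for all `r < n`;
`g, u, v` distinct and off the distinct middle vertices): `P(g|u|v) = Zⁿ`, `P(g|u|v) + P(gu|v) = Wⁿ`, `P(g|u|v) + P(gv|u) = Uⁿ`,
`P(g|u|v) + P(g|uv) = Oⁿ` with `Z = 1 − ha − hb − ab + 2hab`, `W = 1 − hb − ab + hab`, `U = 1 − ha − ab + hab`, `O = 1 − ha − hb + hab`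
(`parallel_iso_mul` and `hubPath_cells`, induction on `n`). [this work] -/
theorem hubPaths_iso (p : Sym2 V → ℝ) (h a b : ℝ) (hgu : g ≠ u) (hgv : g ≠ v) (huv : u ≠ v) (n : ℕ)
    (hx : ∀ i j, i < n → j < n → x i = x j → i = j) (hxg : ∀ j, j < n → x j ≠ g) (hxu : ∀ j, j < n → x j ≠ u)
    (hxv : ∀ j, j < n → x j ≠ v) (hh : ∀ r, r < n → p s(g, x r) = h) (ha : ∀ r, r < n → p s(x r, u) = a)
    (hb : ∀ r, r < n → p s(x r, v) = b) :
    PrW (K n) p {L : Finset (Sym2 V) | u ∉ cl L g ∧ v ∉ cl L g ∧ v ∉ cl L u} = (1 - h * a - h * b - a * b + 2 * (h * a * b)) ^ n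
    ∧ PrW (K n) p {L : Finset (Sym2 V) | u ∉ cl L g ∧ v ∉ cl L g ∧ v ∉ cl L u} + PrW (K n) p {L : Finset (Sym2 V) | u ∈ cl L g ∧ v ∉ cl L g}
        = (1 - h * b - a * b + h * a * b) ^ n
    ∧ PrW (K n) p {L : Finset (Sym2 V) | u ∉ cl L g ∧ v ∉ cl L g ∧ v ∉ cl L u} + PrW (K n) p {L : Finset (Sym2 V) | v ∈ cl L g ∧ u ∉ cl L g}
        = (1 - h * a - a * b + h * a * b) ^ n
    ∧ PrW (K n) p {L : Finset (Sym2 V) | u ∉ cl L g ∧ v ∉ cl L g ∧ v ∉ cl L u}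
          + PrW (K n) p {L : Finset (Sym2 V) | u ∉ cl L g ∧ v ∉ cl L g ∧ v ∈ cl L u}
        = (1 - h * a - h * b + h * a * b) ^ n := by
  induction n with
  | zero =>
    have hD : ∀ f ∈ (∅ : Finset (Sym2 V)), g ∉ f := fun f hf => absurd hf (Finset.notMem_empty f)
    have hDu : ∀ f ∈ (∅ : Finset (Sym2 V)), u ∉ f := fun f hf => absurd hf (Finset.notMem_empty f)
    have h0 : PrW (∅ : Finset (Sym2 V)) p {L : Finset (Sym2 V) | v ∈ cl L u} = 0 := apexFree_p (p := p) ∅ hDu huv.symm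
    rw [hK0, afree_cell_zero p ∅ g u v hgu.symm hgv.symm hD, afree_cell_ab p ∅ g u v hgu.symm hD, afree_cell_ac p ∅ g u v hgv.symm hD,
      afree_cell_bc p ∅ g u v hgu.symm hgv.symm hD, PrW_not_conn_eq p ∅ u v, h0]
    norm_num
  | succ r ih =>
    obtain ⟨iZ, iW, iU, iO⟩ := ih (fun i j hi hj => hx i j (by omega) (by omega)) (fun j hj => hxg j (by omega))
      (fun j hj => hxu j (by omega)) (fun j hj => hxv j (by omega)) (fun j hj => hh j (by omega)) (fun j hj => ha j (by omega))
      (fun j hj => hb j (by omega))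
    -- the new piece is glued to `K r` at `g, u, v` only
    have hfresh : ∀ e ∈ K r, x r ∉ e := fun e he hxe => by
      rcases hubPaths_vertex x g u v K hK0 hKs r he hxe with h' | h' | h' | ⟨j, hj, h'⟩
      · exact hxg r (by omega) h'
      · exact hxu r (by omega) h'
      · exact hxv r (by omega) h'
      · have := hx r j (by omega) (by omega) h'
        omega
    have hdisj : Disjoint (K r) (insert s(g, x r) ({s(x r, u)} ∪ {s(x r, v)})) := by
      rw [Finset.disjoint_iff_ne]
      rintro e he f hf rfl
      rw [Finset.mem_insert, Finset.mem_union, Finset.mem_singleton, Finset.mem_singleton] at hf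
      rcases hf with rfl | rfl | rfl
      · exact hfresh _ he (Sym2.mem_mk_right _ _)
      · exact hfresh _ he (Sym2.mem_mk_left _ _)
      · exact hfresh _ he (Sym2.mem_mk_left _ _)
    have hsep : ∀ y : V, (∃ e ∈ K r, y ∈ e) → (∃ e ∈ (insert s(g, x r) ({s(x r, u)} ∪ {s(x r, v)}) : Finset (Sym2 V)), y ∈ e) →
        (y = g ∨ y = u ∨ y = v) := by
      rintro y ⟨e, he, hye⟩ ⟨f, hf, hyf⟩
      rw [Finset.mem_insert, Finset.mem_union, Finset.mem_singleton, Finset.mem_singleton] at hf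
      rcases hf with rfl | rfl | rfl
      · rcases Sym2.mem_iff.1 hyf with rfl | rfl
        · exact Or.inl rfl
        · exact absurd hye (hfresh e he)
      · rcases Sym2.mem_iff.1 hyf with rfl | rfl
        · exact absurd hye (hfresh e he)
        · exact Or.inr (Or.inl rfl)
      · rcases Sym2.mem_iff.1 hyf with rfl | rfl
        · exact absurd hye (hfresh e he)
        · exact Or.inr (Or.inr rfl)
    obtain ⟨mZ, mW, mU, mO⟩ := parallel_iso_mul p (K r) _ hdisj g u v hsep
    obtain ⟨c0, cB, cA, cM, -⟩ := hubPath_cells p g (x r) u v (hxg r (by omega)).symm hgu hgv (hxu r (by omega)) (hxv r (by omega)) huv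
    rw [hh r (by omega), ha r (by omega), hb r (by omega)] at c0 cB cA cM
    rw [hKs r]
    refine ⟨?_, ?_, ?_, ?_⟩
    · rw [mZ, iZ, c0]; ring
    · rw [mW, iW, c0, cB]; ring
    · rw [mU, iU, c0, cA]; ring
    · rw [mO, iO, c0, cM]; ring

/-- **The four numbers of `(g; u, v)` on the core `K_{3,n}`** (`n` hub paths in parallel): with `Z, W, U, O` as in `hubPaths_iso`,
`P(u ∈ cl g) = 1 − Uⁿ − Oⁿ + Zⁿ`, `P(v ∈ cl g) = 1 − Wⁿ − Oⁿ + Zⁿ`, `P(u, v ∈ cl g) = 1 − Wⁿ − Uⁿ − Oⁿ + 2Zⁿ`, `P(u ∉ cl g, v ∈ cl u) = Oⁿ − Zⁿ`,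
and `P(v ∈ cl u) = 1 − Wⁿ − Uⁿ + Zⁿ`. [this work] -/
theorem hubPaths_numbers (p : Sym2 V → ℝ) (h a b : ℝ) (hgu : g ≠ u) (hgv : g ≠ v) (huv : u ≠ v) (n : ℕ)
    (hx : ∀ i j, i < n → j < n → x i = x j → i = j) (hxg : ∀ j, j < n → x j ≠ g) (hxu : ∀ j, j < n → x j ≠ u)
    (hxv : ∀ j, j < n → x j ≠ v) (hh : ∀ r, r < n → p s(g, x r) = h) (ha : ∀ r, r < n → p s(x r, u) = a)
    (hb : ∀ r, r < n → p s(x r, v) = b) :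
    PrW (K n) p {L : Finset (Sym2 V) | u ∈ cl L g}
        = 1 - (1 - h * a - a * b + h * a * b) ^ n - (1 - h * a - h * b + h * a * b) ^ n + (1 - h * a - h * b - a * b + 2 * (h * a * b)) ^ n
    ∧ PrW (K n) p {L : Finset (Sym2 V) | v ∈ cl L g}
        = 1 - (1 - h * b - a * b + h * a * b) ^ n - (1 - h * a - h * b + h * a * b) ^ n + (1 - h * a - h * b - a * b + 2 * (h * a * b)) ^ n
    ∧ PrW (K n) p {L : Finset (Sym2 V) | u ∈ cl L g ∧ v ∈ cl L g}
        = 1 - (1 - h * b - a * b + h * a * b) ^ n - (1 - h * a - a * b + h * a * b) ^ n - (1 - h * a - h * b + h * a * b) ^ n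
          + 2 * (1 - h * a - h * b - a * b + 2 * (h * a * b)) ^ n
    ∧ PrW (K n) p {L : Finset (Sym2 V) | u ∉ cl L g ∧ v ∈ cl L u}
        = (1 - h * a - h * b + h * a * b) ^ n - (1 - h * a - h * b - a * b + 2 * (h * a * b)) ^ n
    ∧ PrW (K n) p {L : Finset (Sym2 V) | v ∈ cl L u}
        = 1 - (1 - h * b - a * b + h * a * b) ^ n - (1 - h * a - a * b + h * a * b) ^ n
          + (1 - h * a - h * b - a * b + 2 * (h * a * b)) ^ n := by
  obtain ⟨iZ, iW, iU, iO⟩ := hubPaths_iso x g u v K hK0 hKs p h a b hgu hgv huv n hx hxg hxu hxv hh ha hb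
  have hsum := cells_sum_eq_one p (K n) g u v
  rw [conn_eq_cells_b p (K n) g u v, conn_eq_cells_c p (K n) g u v, m_event_eq_cell p (K n) g u v, pendant_split_bc' p (K n) g u v]
  refine ⟨?_, ?_, ?_, ?_, ?_⟩
  · linear_combination hsum - iU - iO + iZ
  · linear_combination hsum - iW - iO + iZ
  · linear_combination hsum - iW - iU - iO + 2 * iZ
  · linear_combination iO - iZ
  · linear_combination hsum - iW - iU + iZ

/-- **The three-point inequality with constant `28/27` fails outside series–parallel graphs.**  On the core `K_{3,4}` (four hub paths,
all weights `1/3`): `(106/100)·P(u ∈ cl g)·P(v ∈ cl g)·P(v ∈ cl u) < P(u, v ∈ cl g)²` (exact ratio `148673²·3¹²/222929³ = 1.06027…`; compare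
`sp_threePoint_le'`: `≤ 28/27 = 1.0370…` whenever the `u–v` graph is two-terminal series–parallel). [this work] -/
theorem hubPaths_threePoint_gt (p : Sym2 V → ℝ) (hgu : g ≠ u) (hgv : g ≠ v) (huv : u ≠ v)
    (hx : ∀ i j, i < 4 → j < 4 → x i = x j → i = j) (hxg : ∀ j, j < 4 → x j ≠ g) (hxu : ∀ j, j < 4 → x j ≠ u)
    (hxv : ∀ j, j < 4 → x j ≠ v) (hh : ∀ r, r < 4 → p s(g, x r) = 1 / 3) (ha : ∀ r, r < 4 → p s(x r, u) = 1 / 3)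
    (hb : ∀ r, r < 4 → p s(x r, v) = 1 / 3) :
    106 / 100 * (PrW (K 4) p {L : Finset (Sym2 V) | u ∈ cl L g} * PrW (K 4) p {L : Finset (Sym2 V) | v ∈ cl L g}
        * PrW (K 4) p {L : Finset (Sym2 V) | v ∈ cl L u})
      < PrW (K 4) p {L : Finset (Sym2 V) | u ∈ cl L g ∧ v ∈ cl L g} ^ 2 := by
  obtain ⟨np, nπ, nτ, -, ns⟩ := hubPaths_numbers x g u v K hK0 hKs p (1 / 3) (1 / 3) (1 / 3) hgu hgv huv 4 hx hxg hxu hxv hh ha hb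
  rw [np, nπ, nτ, ns]
  norm_num

/-- **Apex excess over `K_{3,4}`.**  With the apex `o` pendant at `g` (edge `s(o, g)` of weight `1/10000`, `o` off the core) over the core
`K_{3,4}` with all weights `1/3`, the network `(o; u, v)` has `pπm > 0` and `(53/50)·pπm < κ²`, i.e. `E = κ²/(pπm) > 1.06 > 28/27`
(`p = P(u ∈ cl o)`, `π = P(v ∈ cl o)`, `m = P(u ∉ cl o, v ∈ cl u)`, `κ = P(u,v ∈ cl o) − pπ`; exact value `E = 1.060214…`). [this work] -/
theorem hubPaths_apex_excess (p : Sym2 V → ℝ) (o : V) (hog : o ≠ g) (hou : o ≠ u) (hov : o ≠ v) (hgu : g ≠ u) (hgv : g ≠ v)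
    (huv : u ≠ v) (hx : ∀ i j, i < 4 → j < 4 → x i = x j → i = j) (hxo : ∀ j, j < 4 → x j ≠ o) (hxg : ∀ j, j < 4 → x j ≠ g)
    (hxu : ∀ j, j < 4 → x j ≠ u) (hxv : ∀ j, j < 4 → x j ≠ v) (ho : p s(o, g) = 1 / 10000) (hh : ∀ r, r < 4 → p s(g, x r) = 1 / 3)
    (ha : ∀ r, r < 4 → p s(x r, u) = 1 / 3) (hb : ∀ r, r < 4 → p s(x r, v) = 1 / 3) :
    0 < PrW (insert s(o, g) (K 4)) p {L : Finset (Sym2 V) | u ∈ cl L o} * PrW (insert s(o, g) (K 4)) p {L : Finset (Sym2 V) | v ∈ cl L o}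
          * PrW (insert s(o, g) (K 4)) p {L : Finset (Sym2 V) | u ∉ cl L o ∧ v ∈ cl L u}
    ∧ 53 / 50 * (PrW (insert s(o, g) (K 4)) p {L : Finset (Sym2 V) | u ∈ cl L o} * PrW (insert s(o, g) (K 4)) p {L : Finset (Sym2 V) | v ∈ cl L o}
          * PrW (insert s(o, g) (K 4)) p {L : Finset (Sym2 V) | u ∉ cl L o ∧ v ∈ cl L u})
      < (PrW (insert s(o, g) (K 4)) p {L : Finset (Sym2 V) | u ∈ cl L o ∧ v ∈ cl L o}
          - PrW (insert s(o, g) (K 4)) p {L : Finset (Sym2 V) | u ∈ cl L o} * PrW (insert s(o, g) (K 4)) p {L : Finset (Sym2 V) | v ∈ cl L o}) ^ 2 := by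
  obtain ⟨np, nπ, nτ, nm, -⟩ := hubPaths_numbers x g u v K hK0 hKs p (1 / 3) (1 / 3) (1 / 3) hgu hgv huv 4 hx hxg hxu hxv hh ha hb
  have hR : ∀ f ∈ K 4, o ∉ f := fun f hf hof => by
    rcases hubPaths_vertex x g u v K hK0 hKs 4 hf hof with h' | h' | h' | ⟨j, hj, h'⟩
    · exact hog h'
    · exact hou h'
    · exact hov h'
    · exact hxo j hj h'.symm
  obtain ⟨ap, aπ, aτ, am⟩ := pendant_apex_numbers p (K 4) o g u v hog hou.symm hov.symm hR
  rw [ap, aπ, aτ, am, np, nπ, nτ, nm, ho]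
  constructor
  · norm_num
  · norm_num

end HubPaths

/-! ### The concrete graph -/

/-- **`E > 1.06` beyond series–parallel** (abstract form).  In every finite vertex set with eight distinct vertices `z 0, …, z 7` the network with
apex `o = z 0` pendant at `g = z 1` (weight `10⁻⁴`), ports `u = z 2`, `v = z 3` and the core `K_{3,4} = {g, u, v} × {z 4, …, z 7}` (weight `1/3`)
has `pπm > 0` and `(53/50)·pπm < κ²`. [this work] -/
theorem hubPaths_excess (W : Type*) [Fintype W] (z : ℕ → W) (hz : ∀ i j, i ≤ 7 → j ≤ 7 → z i = z j → i = j) :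
    ∃ (p : Sym2 W → ℝ) (E : Finset (Sym2 W)), (∀ e, 0 ≤ p e ∧ p e ≤ 1)
      ∧ 0 < PrW E p {K : Finset (Sym2 W) | z 2 ∈ cl K (z 0)} * PrW E p {K : Finset (Sym2 W) | z 3 ∈ cl K (z 0)}
            * PrW E p {K : Finset (Sym2 W) | z 2 ∉ cl K (z 0) ∧ z 3 ∈ cl K (z 2)}
      ∧ 53 / 50 * (PrW E p {K : Finset (Sym2 W) | z 2 ∈ cl K (z 0)} * PrW E p {K : Finset (Sym2 W) | z 3 ∈ cl K (z 0)}
            * PrW E p {K : Finset (Sym2 W) | z 2 ∉ cl K (z 0) ∧ z 3 ∈ cl K (z 2)})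
          < (PrW E p {K : Finset (Sym2 W) | z 2 ∈ cl K (z 0) ∧ z 3 ∈ cl K (z 0)}
              - PrW E p {K : Finset (Sym2 W) | z 2 ∈ cl K (z 0)} * PrW E p {K : Finset (Sym2 W) | z 3 ∈ cl K (z 0)}) ^ 2 := by
  -- vertices: apex z 0, g = z 1, u = z 2, v = z 3, middle vertices x r = z (4 + r)
  let x : ℕ → W := fun j => z (4 + j)
  let K : ℕ → Finset (Sym2 W) := fun k =>
    Nat.rec (∅ : Finset (Sym2 W)) (fun r Kr => Kr ∪ insert s(z 1, x r) ({s(x r, z 2)} ∪ {s(x r, z 3)})) k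
  have hK0 : K 0 = ∅ := rfl
  have hKs : ∀ r : ℕ, K (r + 1) = K r ∪ insert s(z 1, x r) ({s(x r, z 2)} ∪ {s(x r, z 3)}) := fun r => rfl
  let p : Sym2 W → ℝ := fun e => if z 0 ∈ e then 1 / 10000 else 1 / 3
  have hp01 : ∀ e, 0 ≤ p e ∧ p e ≤ 1 := by
    intro e
    simp only [p]
    split_ifs <;> norm_num
  have hne : ∀ i j, i ≤ 7 → j ≤ 7 → i ≠ j → z i ≠ z j := fun i j hi hj hij h => hij (hz i j hi hj h)
  have hx : ∀ i j, i < 4 → j < 4 → x i = x j → i = j := fun i j hi hj hij => by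
    have := hz (4 + i) (4 + j) (by omega) (by omega) hij
    omega
  have hxo : ∀ j, j < 4 → x j ≠ z 0 := fun j hj => hne (4 + j) 0 (by omega) (by omega) (by omega)
  have hxg : ∀ j, j < 4 → x j ≠ z 1 := fun j hj => hne (4 + j) 1 (by omega) (by omega) (by omega)
  have hxu : ∀ j, j < 4 → x j ≠ z 2 := fun j hj => hne (4 + j) 2 (by omega) (by omega) (by omega)
  have hxv : ∀ j, j < 4 → x j ≠ z 3 := fun j hj => hne (4 + j) 3 (by omega) (by omega) (by omega)
  have ho : p s(z 0, z 1) = 1 / 10000 := by simp only [p, if_pos (Sym2.mem_mk_left (z 0) (z 1))]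
  have hoff : ∀ y t : W, y ≠ z 0 → t ≠ z 0 → p s(y, t) = 1 / 3 := fun y t hy ht => by
    simp only [p]
    rw [if_neg]
    intro hmem
    rcases Sym2.mem_iff.1 hmem with h' | h'
    · exact hy h'.symm
    · exact ht h'.symm
  have hh : ∀ r, r < 4 → p s(z 1, x r) = 1 / 3 := fun r hr => hoff (z 1) (x r) (hne 1 0 (by omega) (by omega) (by omega)) (hxo r hr)
  have ha : ∀ r, r < 4 → p s(x r, z 2) = 1 / 3 := fun r hr => hoff (x r) (z 2) (hxo r hr) (hne 2 0 (by omega) (by omega) (by omega))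
  have hb : ∀ r, r < 4 → p s(x r, z 3) = 1 / 3 := fun r hr => hoff (x r) (z 3) (hxo r hr) (hne 3 0 (by omega) (by omega) (by omega))
  obtain ⟨h1, h2⟩ := hubPaths_apex_excess x (z 1) (z 2) (z 3) K hK0 hKs p (z 0) (hne 0 1 (by omega) (by omega) (by omega))
    (hne 0 2 (by omega) (by omega) (by omega)) (hne 0 3 (by omega) (by omega) (by omega)) (hne 1 2 (by omega) (by omega) (by omega))
    (hne 1 3 (by omega) (by omega) (by omega)) (hne 2 3 (by omega) (by omega) (by omega)) hx hxo hxg hxu hxv ho hh ha hb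
  exact ⟨p, insert s(z 0, z 1) (K 4), hp01, h1, h2⟩

/-- **`E > 1.06 > 28/27` BEYOND SERIES–PARALLEL (concrete form).**  There is an explicit finite weighted graph — `Fin 8` with apex `o = 0`,
`g = 1`, ports `u = 2`, `v = 3`, middle vertices `4, 5, 6, 7`; the 12 core edges `{1,2,3} × {4,5,6,7}` (a `K_{3,4}`) of weight `1/3` and the
pendant apex edge `s(0,1)` of weight `10⁻⁴` — with weights in `[0,1]`, `P(u ∈ cl o)P(v ∈ cl o)P(u ∉ cl o, v ∈ cl u) > 0` and
`(53/50)·P(u ∈ cl o)P(v ∈ cl o)P(u ∉ cl o, v ∈ cl u) < (P(u,v ∈ cl o) − P(u ∈ cl o)P(v ∈ cl o))²`.  So the supremum of `E = κ²/(pπm)` over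
all finite weighted graphs is `> 1.06`, strictly above the series–parallel supremum `28/27` of `sp_E_le` / `sp_E_le_sharp`: beyond two-terminal
series–parallel graphs the constant must grow (the lineage's numerical supremum is `≈ 1.18`, memo gen 56). [this work] -/
theorem exists_E_gt_beyondSP :
    ∃ (N : ℕ) (p : Sym2 (Fin N) → ℝ) (o u v : Fin N) (E : Finset (Sym2 (Fin N))), (∀ e, 0 ≤ p e ∧ p e ≤ 1)
      ∧ 0 < PrW E p {K : Finset (Sym2 (Fin N)) | u ∈ cl K o} * PrW E p {K : Finset (Sym2 (Fin N)) | v ∈ cl K o}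
            * PrW E p {K : Finset (Sym2 (Fin N)) | u ∉ cl K o ∧ v ∈ cl K u}
      ∧ 53 / 50 * (PrW E p {K : Finset (Sym2 (Fin N)) | u ∈ cl K o} * PrW E p {K : Finset (Sym2 (Fin N)) | v ∈ cl K o}
            * PrW E p {K : Finset (Sym2 (Fin N)) | u ∉ cl K o ∧ v ∈ cl K u})
          < (PrW E p {K : Finset (Sym2 (Fin N)) | u ∈ cl K o ∧ v ∈ cl K o}
              - PrW E p {K : Finset (Sym2 (Fin N)) | u ∈ cl K o} * PrW E p {K : Finset (Sym2 (Fin N)) | v ∈ cl K o}) ^ 2 := by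
  let z : ℕ → Fin 8 := fun j => if hj : j < 8 then ⟨j, hj⟩ else 0
  have hz : ∀ i j, i ≤ 7 → j ≤ 7 → z i = z j → i = j := fun i j hi hj hij => by
    simp only [z, dif_pos (show i < 8 by omega), dif_pos (show j < 8 by omega), Fin.mk.injEq] at hij
    exact hij
  obtain ⟨p, E, h1, h2, h3⟩ := hubPaths_excess (Fin 8) z hz
  refine ⟨8, p, z 0, z 2, z 3, E, h1, ?_, ?_⟩
  · convert h2
  · convert h3

end APL

end Summit.CriticalPhenomena.PercolationContinuityZ3.Theorems
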